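import Summits.QuantumFields.BalabanUV.Beta.CompositeOneShotTablesAnchor
import Summits.QuantumFields.BalabanUV.Beta.CompositeOneShotJetsGraded
import Summits.QuantumFields.BalabanUV.Beta.SymTablesAn1S2Weighted

/-!
# `BalabanUV.Beta.CompositeOneShotTablesWeighted` — row D1 ∕ (C1) OWNER «beta-an2», PART 121: **THE COMPOSITE TABLE RECORD AT A WEIGHTED MIXED SLOT**
# (`tabsCompW r L m cM w`, graded twin `tabsCompGW`), **THE SCALED GROUP WEIGHT** `compGroupWeight Lc m = ((Lc⁴)^m)³∕4`, AND **THE WEIGHTED DEPTH-ONE ANCHOR (H-2w)**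
# `tabsCompW ctrOff Lc 1 (cΛ·wM1) w ≅ symTablesAn1S2w 3 Lc cΛ w` with its transported one-shot kernel identity — the row's (L-ii″) items (b)(c) (journal [AN2-G87-W-12] (A), road FP g65 A-6∕A-7)

HONEST DEPENDENCY (page 1, mandatory): continuum YM on T⁴ ⇐ BetaPertH ∧ nine spine estimates (0/9 proved); BetaPertH ⇐ (D1) ∧ (D4) ∧ CAP+tail;
G-an2-4 gates asym, D1 and NE2/3/4.  HONEST FRAMING (cell contract, verbatim): «discharging `BetaPertH` makes Bałaban's UV stability UNCONDITIONAL —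
a real constructive-QFT result; it is NOT the continuum limit and NOT the Clay problem.»  ABSOLUTE RULE (cell charter, verbatim): «No internally-minted
statement may enter as a cited fact. Every hypothesis is either kernel-proved in this package or a verbatim quotation of a PUBLISHED theorem with page
reference. The manuscript(s) under audit are NOT citable for their own disputed steps — they are the thing under adjudication; programme-internal
(2001/route/tribunal) claims are never citable.»

WHY (an2 g56 ∕ g87; `gen87/UNIT-JUNCTION-87.md` §8; PART 119 v3 `FP/TowerWardPinLocks.literalFlow_of_weight` ∕ `weight_three_two`; road FP g65 A-6 (A), journal l.69451∕l.69453; W-12).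
The END of record as typed targets the κ = 1 root M‴ (`JsB12CombShSym hLc N (symTablesAn1S2 3 Lc cΛ) cΛ cB`); the consistent END″ targets the root of record P5c∕D6
(`CombRemainderParityAllScaled` L.231 ∕ `D1LiteralLagrangianRoot` L.88: `JsB12CombShSym hLc N (symTablesAn1S2w 3 Lc (w·cΛ) w) (w·cΛ) cB`, `w = Lc¹²∕4` = an2 g56's located group weight κ*).
Its composite side needs (i) a composite table record whose MIXED SLOT carries a weight (the four other tables unchanged; the multiplier family `cM` is already free in `tabsComp`),
(ii) the weight's flow with depth, `w_m = ((Lc⁴)^m)³∕4` (one storey = `Lc¹²`; `w_1 = Lc¹²∕4`, `w_2 = 3²⁴∕4` at `Lc = 3` — TEL2's unit junction, PART 119 v3), and (iii) the depth-one anchor: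
the weighted composite record at `r = ctrOff`, `m = 1`, `cM = cΛ·wM1` IS leaf-04's weighted (0.4) record `symTablesAn1S2w 3 Lc cΛ w` along `Lc¹ = Lc`, so that for any scale-indexed
record whose scale-1 member is it, `TshotOf Lc (JcOfTabs hLc N tabs cΛ cB) 1 = TbalOf Lc (JsB12CombShSym hLc N (symTablesAn1S2w 3 Lc (cΛ 1) (w 1)) (cΛ 1) (cB 1)) 0` — the `hbase`∕anchor
row of an END″ whose target is the weighted root (road FP g65 A-7: «`TowerFAnchorWardRecordW` … for ANY `Jc` with `TshotOf Jc 1 = TbalOf JsW 0` + the `JcOfTabs` instance»).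

WHAT ([our objects — bookkeeping] + [folklore] packaging BY NAME):
* §1 two weight letters for ANY field–multiplier table: `locStencilFM_smul` (constant `|w|·C`, same rate; `StepJetData.biLoc_smul`) and `hmixt_smul` (translation covariance is linear;
  `SymTablesAn1S2Weighted.shiftK_smul`).
* §2 **`tabsCompW r L m cM w`** := `tabsOf (L^m) (compV r L m) (compH r L m) cM (compB r L m) (w • compMix r L m)` (+ letters), its `rfl` field lemmas, `tabsCompW_one : tabsCompW … 1 = tabsComp …`;
  the graded twin **`tabsCompGW r L m cM w`** (`mixFF := w • compMixG r L m`, PART 92's `tabsCompG` at the weighted slot), field lemmas, `tabsCompGW_one`.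
* §3 **`compGroupWeight Lc m := (((Lc:ℝ)^4)^m)^3 ∕ 4`** with `compGroupWeight_zero = 1∕4`, `compGroupWeight_one = Lc¹²∕4`, `compGroupWeight_succ = Lc¹² · compGroupWeight m` (the per-storey
  flow), `compGroupWeight_three_two = 3²⁴∕4` (= TEL2's 7.06e10, `weight_three_two`'s number).
* §4 **(H-2w) `tabsCompW_one_heq_symTablesAn1S2w`**: `HEq (tabsCompW (r := ctrOff 4 Lc) 1 … (fun j ↦ cΛ·wM1 3 Lc j) w) (symTablesAn1S2w 3 Lc cΛ w)` — PART F6d-1c's field-by-field proof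
  with the mixed field `w • compMix ctrOff Lc 1 = w • symMixFFAt (ctr 4 Lc) Lc` (`compMix_one`); the graded twin `tabsCompGW_one_heq_symTablesAn1S2w` (`compMixG_one`).
* §5 kernel transport: **`TOf_JsB12CombShSym_tabsCompW_one`**, **`TshotOf_JcOfTabs_one_of_tabsCompW`** (and `…GW`) — `CombOneShotJetsTabs.TOf_JsB12CombShSym_congr_heq` ∕
  `TshotOf_JcOfTabs_one` at the weighted record.
WHAT THIS IS NOT: not (H-1) (the chart), not the pins (parameters), not a record `JNatW`∕`JcCompW` over the tower (the END″ author's ∕ the referee-gated (O3) port), no pin VALUE asserted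
(`w`, `cΛ`, `cM` free; §3 only NAMES the flow the END″ will instantiate); nothing of Bałaban's asserted, valued or discharged; 0 estimates; 0∕4 row-D1 binders; ROOT M‴ ∕ P5c ∕ D6
UNCHANGED; NOT (C1), NOT (T-ID), NOT D1, NEVER «G-an2-4 closed», NOT BetaPertH, NOT continuum, NOT Clay.  Row D1 ∕ (C1) OWNER «beta-an2», gen 88, 2026-08-30.  No existing file touched.
-/

noncomputable section

namespace Summit.QuantumFields.BalabanUV.Beta.CompositeOneShotTablesWeighted

open Literature.MathematicalPhysics.QuantumFieldTheory
open Literature.MathematicalPhysics.QuantumFieldTheory.Balaban1983to89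
open Literature.MathematicalPhysics.QuantumFieldTheory.Balaban1983to89.Beta
open ExpKernelCalculus (MKer BiLoc shiftK)
open AffineAveraging (Site box toSite)
open AveragingContoursRooted (ctr ctrOff ctrOff_mem_box)
open OneStepResolventKernel (Fib TOf)
open OneStepKernelFamily (TshotOf TbalOf)
open SecondOrderResponse (LocStencilFM)
open BalabanStepW2 (wM1)
open Summit.QuantumFields.BalabanUV.Beta.SpineRooted (M1Of M1Of_apply)
open Summit.QuantumFields.BalabanUV.Beta.SymmetrisedStepJets (SymTables)
open Summit.QuantumFields.BalabanUV.Beta.SymTablesOf (tabsOf)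
open Summit.QuantumFields.BalabanUV.Beta.SymTablesAn1S2Weighted (symTablesAn1S2w symTablesAn1S2w_V symTablesAn1S2w_H symTablesAn1S2w_M symTablesAn1S2w_vh₂S symTablesAn1S2w_mixFF
  shiftK_smul)
open Summit.QuantumFields.BalabanUV.Beta.CombChartJointEnd (JsB12CombShSym)
open Summit.QuantumFields.BalabanUV.Beta.CombOneShotJetsTabs (JcOfTabs TOf_JsB12CombShSym_congr_heq TshotOf_JcOfTabs_one)
open Summit.QuantumFields.BalabanUV.Beta.CompositeOneShotJets (compV compH compB compMix tabsComp compV_hV compH_hH compB_hB compMix_hmix compV_hVt compH_hHt compB_hBt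
  compMix_hmixt compV_one compH_one compB_ctrOff_one compMix_one)
open Summit.QuantumFields.BalabanUV.Beta.CompositeOneShotJetsGraded (tabsCompG)
open Summit.QuantumFields.BalabanUV.Beta.CompositeMixedTableGraded (compMixG)
open Summit.QuantumFields.BalabanUV.Beta.CompositeMixedTableGradedCov (compMixG_translate compMixG_one)
open Summit.QuantumFields.BalabanUV.Beta.CompositeMixedTableGradedBounds (compMixG_hmix)
open Summit.QuantumFields.BalabanUV.Beta.CompositeOneShotTablesAnchor (symTables_ext symTables_heq_of_fields)

variable {d : ℕ}

/-! ## §1 Weight letters for any field–multiplier table -/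

section Letters

variable {N : ℕ} {T : Fin (d + 1) → Site (d + 1) → Fin (d + 1) → Site (d + 1) → MKer (d + 1) (Fib d)}

/-- [folklore] **(Lmix-w) for any table**: `w • T` is a localised field–multiplier family at `T`'s rate, constant `|w|·C` (`StepJetData.biLoc_smul`). -/
theorem locStencilFM_smul (h : ∃ C δ : ℝ, 0 < δ ∧ LocStencilFM N T C δ) (w : ℝ) : ∃ C δ : ℝ, 0 < δ ∧ LocStencilFM N (w • T) C δ := by
  obtain ⟨C, δ, hδ, h⟩ := h
  refine ⟨|w| * C, δ, hδ, fun κ u μ y => ?_⟩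
  have h1 := StepJetData.biLoc_smul (h κ u μ y) w
  rw [← mul_assoc] at h1
  exact h1

/-- [folklore] **(Tmix-w) for any table**: translation covariance passes to `w • T` (`shiftK` commutes with the scalar, `rfl`). -/
theorem hmixt_smul
    (h : ∀ (κ : Fin (d + 1)) (u : Site (d + 1)) (μ : Fin (d + 1)) (y t : Site (d + 1)), T κ (u + (N : ℤ) • t) μ (y + t) = shiftK (-((N : ℤ) • t)) (T κ u μ y))
    (w : ℝ) :
    ∀ (κ : Fin (d + 1)) (u : Site (d + 1)) (μ : Fin (d + 1)) (y t : Site (d + 1)),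
      (w • T) κ (u + (N : ℤ) • t) μ (y + t) = shiftK (-((N : ℤ) • t)) ((w • T) κ u μ y) := by
  intro κ u μ y t
  simp only [Pi.smul_apply, h κ u μ y t]
  rfl

end Letters

/-! ## §2 The composite record at a weighted mixed slot, plain and graded -/

section Tables

variable {r : Fin (d + 1) → ℕ} {L : ℕ} (m : ℕ) (hL : 1 ≤ L) (hr : r ∈ box (d + 1) L)

/-- [our object — bookkeeping] **THE COMPOSITE TABLE RECORD AT DEPTH `m` WITH THE MIXED SLOT AT WEIGHT `w`**: F6d-1b's `tabsComp r L m cM` with `mixFF := w • compMix r L m`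
(letters by §1 over `compMix_hmix` ∕ `compMix_hmixt`); `V, H, M, vh₂S` unchanged; `cM` and `w` free. -/
def tabsCompW (cM : ℕ → ℝ) (w : ℝ) : SymTables d (L ^ m) :=
  tabsOf (L ^ m) (compV r L m) (compH r L m) cM (compB r L m) (w • compMix r L m)
    (compV_hV m hL hr) (compH_hH m hL hr) (compB_hB m hL hr) (locStencilFM_smul (compMix_hmix m hL hr) w)
    (compV_hVt m hL) (compH_hHt m) (compB_hBt m hL) (hmixt_smul (by exact_mod_cast compMix_hmixt (r := r) (L := L) m) w)

/-- [folklore] (`rfl`). -/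
theorem tabsCompW_V (cM : ℕ → ℝ) (w : ℝ) : (tabsCompW m hL hr cM w).V = compV r L m := rfl

/-- [folklore] (`rfl`). -/
theorem tabsCompW_H (cM : ℕ → ℝ) (w : ℝ) : (tabsCompW m hL hr cM w).H = compH r L m := rfl

/-- [folklore] (`rfl`). -/
theorem tabsCompW_M_apply (cM : ℕ → ℝ) (w : ℝ) (j : ℕ) (μ : Fin (d + 1)) (y : Site (d + 1)) : (tabsCompW m hL hr cM w).M j μ y = cM j • compH r L m μ y := rfl

/-- [folklore] (`rfl`). -/
theorem tabsCompW_vh₂S (cM : ℕ → ℝ) (w : ℝ) : (tabsCompW m hL hr cM w).vh₂S = compB r L m := rfl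

/-- [folklore] (`rfl`): THE WEIGHTED SLOT. -/
theorem tabsCompW_mixFF (cM : ℕ → ℝ) (w : ℝ) : (tabsCompW m hL hr cM w).mixFF = w • compMix r L m := rfl

/-- [folklore] the four unweighted fields agree with `tabsComp`'s (`rfl`). -/
theorem tabsCompW_tables_eq (cM : ℕ → ℝ) (w : ℝ) :
    (tabsCompW m hL hr cM w).V = (tabsComp m hL hr cM).V ∧ (tabsCompW m hL hr cM w).H = (tabsComp m hL hr cM).H ∧
      (tabsCompW m hL hr cM w).M = (tabsComp m hL hr cM).M ∧ (tabsCompW m hL hr cM w).vh₂S = (tabsComp m hL hr cM).vh₂S :=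
  ⟨rfl, rfl, rfl, rfl⟩

/-- [folklore] the weighted slot against `tabsComp`'s (`rfl`). -/
theorem tabsCompW_mixFF_eq_smul (cM : ℕ → ℝ) (w : ℝ) : (tabsCompW m hL hr cM w).mixFF = w • (tabsComp m hL hr cM).mixFF := rfl

/-- [folklore] **WEIGHT ONE IS `tabsComp`** (`one_smul` + extensionality in the five data fields). -/
theorem tabsCompW_one (cM : ℕ → ℝ) : tabsCompW m hL hr cM 1 = tabsComp m hL hr cM :=
  symTables_ext rfl rfl rfl rfl (by rw [tabsCompW_mixFF, one_smul]; rfl)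

/-- [folklore] weights compose in the mixed slot. -/
theorem tabsCompW_mul_mixFF (cM : ℕ → ℝ) (w w' : ℝ) : (tabsCompW m hL hr cM (w * w')).mixFF = w • (tabsCompW m hL hr cM w').mixFF := by
  rw [tabsCompW_mixFF, tabsCompW_mixFF, mul_smul]

/-- [our object — bookkeeping] **THE GRADED COMPOSITE TABLE RECORD AT DEPTH `m` WITH THE MIXED SLOT AT WEIGHT `w`**: PART 92's `tabsCompG r L m cM` with
`mixFF := w • compMixG r L m`. -/
def tabsCompGW (cM : ℕ → ℝ) (w : ℝ) : SymTables d (L ^ m) :=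
  tabsOf (L ^ m) (compV r L m) (compH r L m) cM (compB r L m) (w • compMixG r L m)
    (compV_hV m hL hr) (compH_hH m hL hr) (compB_hB m hL hr) (locStencilFM_smul (compMixG_hmix hL hr m) w)
    (compV_hVt m hL) (compH_hHt m) (compB_hBt m hL) (hmixt_smul (by exact_mod_cast fun κ u μ y t => compMixG_translate (r := r) (L := L) m κ u μ y t) w)

/-- [folklore] (`rfl`). -/
theorem tabsCompGW_V (cM : ℕ → ℝ) (w : ℝ) : (tabsCompGW m hL hr cM w).V = compV r L m := rfl

/-- [folklore] (`rfl`). -/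
theorem tabsCompGW_H (cM : ℕ → ℝ) (w : ℝ) : (tabsCompGW m hL hr cM w).H = compH r L m := rfl

/-- [folklore] (`rfl`). -/
theorem tabsCompGW_M_apply (cM : ℕ → ℝ) (w : ℝ) (j : ℕ) (μ : Fin (d + 1)) (y : Site (d + 1)) : (tabsCompGW m hL hr cM w).M j μ y = cM j • compH r L m μ y := rfl

/-- [folklore] (`rfl`). -/
theorem tabsCompGW_vh₂S (cM : ℕ → ℝ) (w : ℝ) : (tabsCompGW m hL hr cM w).vh₂S = compB r L m := rfl

/-- [folklore] (`rfl`): THE WEIGHTED GRADED SLOT. -/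
theorem tabsCompGW_mixFF (cM : ℕ → ℝ) (w : ℝ) : (tabsCompGW m hL hr cM w).mixFF = w • compMixG r L m := rfl

/-- [folklore] **WEIGHT ONE IS `tabsCompG`**. -/
theorem tabsCompGW_one (cM : ℕ → ℝ) : tabsCompGW m hL hr cM 1 = tabsCompG m hL hr cM :=
  symTables_ext rfl rfl rfl rfl (by rw [tabsCompGW_mixFF, one_smul]; rfl)

end Tables

/-! ## §3 The scaled group weight and its per-storey flow -/

section Weight

/-- [our object — bookkeeping] **THE Λ∕MULTIPLIER∕MIXED GROUP WEIGHT AT COMPOSITE DEPTH `m`**: `w_m := ((Lc⁴)^m)³ ∕ 4` (an2 g56's κ* = `Lc¹²∕4` at `m = 1`, flowing by `Lc¹²` per storey;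
`UNIT-JUNCTION-87.md` §5∕§8, PART 119 v3).  A NAME for the END″ author's pin; no value is asserted of any table. -/
def compGroupWeight (Lc m : ℕ) : ℝ := (((Lc : ℝ) ^ 4) ^ m) ^ 3 / 4

/-- [folklore] unfolding (`rfl`). -/
theorem compGroupWeight_def (Lc m : ℕ) : compGroupWeight Lc m = (((Lc : ℝ) ^ 4) ^ m) ^ 3 / 4 := rfl

/-- [folklore] depth 0: `w_0 = 1∕4`. -/
theorem compGroupWeight_zero (Lc : ℕ) : compGroupWeight Lc 0 = 1 / 4 := by
  simp [compGroupWeight]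

/-- [folklore] depth 1: `w_1 = Lc¹²∕4` — an2 g56's κ* (root of record D6's weight). -/
theorem compGroupWeight_one (Lc : ℕ) : compGroupWeight Lc 1 = (Lc : ℝ) ^ 12 / 4 := by
  simp only [compGroupWeight, pow_one]
  ring

/-- [folklore] **THE PER-STOREY FLOW**: `w_{m+1} = Lc¹² · w_m`. -/
theorem compGroupWeight_succ (Lc m : ℕ) : compGroupWeight Lc (m + 1) = (Lc : ℝ) ^ 12 * compGroupWeight Lc m := by
  simp only [compGroupWeight, pow_succ]
  ring

/-- [folklore] `w_m` as one power: `(Lc:ℝ)^(12·m) ∕ 4`. -/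
theorem compGroupWeight_eq_pow (Lc m : ℕ) : compGroupWeight Lc m = (Lc : ℝ) ^ (12 * m) / 4 := by
  simp only [compGroupWeight, ← pow_mul]
  ring_nf

/-- [folklore] `0 < w_m` for `Lc ≠ 0`. -/
theorem compGroupWeight_pos {Lc : ℕ} (hLc : Lc ≠ 0) (m : ℕ) : 0 < compGroupWeight Lc m := by
  have h : (0 : ℝ) < (Lc : ℝ) := by exact_mod_cast Nat.pos_of_ne_zero hLc
  unfold compGroupWeight
  positivity

/-- [folklore] **THE NUMBER AT (2,3)**: `w_2 = 3²⁴∕4` at `Lc = 3` (TEL2's unit junction 7.06e10; PART 119 v3 `weight_three_two`). -/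
theorem compGroupWeight_three_two : compGroupWeight 3 2 = (3 : ℝ) ^ 24 / 4 := by
  rw [compGroupWeight_eq_pow]
  norm_num

end Weight

/-! ## §4 (H-2w): the weighted depth-one composite record IS leaf-04's weighted (0.4) record -/

section Anchor

variable {Lc : ℕ} [NeZero Lc]

/-- [folklore] **(H-2w) — THE DEPTH-ONE WEIGHTED COMPOSITE RECORD AT THE CENTRED ROOT IS `symTablesAn1S2w 3 Lc cΛ w`**, heterogeneously along `Lc¹ = Lc`: F6d-1c's four anchors
field by field (`compV_one`, `compH_one`, `M1Of_apply`, `compB_ctrOff_one`) and the weighted mixed field by `compMix_one` under `w • _`. -/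
theorem tabsCompW_one_heq_symTablesAn1S2w (hLc : 1 ≤ Lc) (cΛ w : ℝ) :
    HEq (tabsCompW (r := ctrOff (3 + 1) Lc) (L := Lc) 1 hLc (ctrOff_mem_box hLc) (fun j => cΛ * wM1 3 Lc j) w) (symTablesAn1S2w 3 Lc cΛ w) := by
  refine symTables_heq_of_fields (pow_one Lc) ?_ ?_ ?_ ?_ ?_
  · rw [tabsCompW_V, symTablesAn1S2w_V]
    exact compV_one (ctrOff_mem_box hLc)
  · rw [tabsCompW_H, symTablesAn1S2w_H]
    exact compH_one (ctrOff_mem_box hLc)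
  · rw [symTablesAn1S2w_M]
    funext j μ y
    rw [M1Of_apply]
    show (cΛ * wM1 3 Lc j) • compH (ctrOff (3 + 1) Lc) Lc 1 μ y = _
    rw [compH_one (ctrOff_mem_box hLc)]
    rfl
  · rw [tabsCompW_vh₂S, symTablesAn1S2w_vh₂S]
    exact compB_ctrOff_one hLc
  · rw [tabsCompW_mixFF, symTablesAn1S2w_mixFF, compMix_one (ctrOff_mem_box hLc)]
    rfl

/-- [folklore] **(H-2w), graded twin** — at depth one the graded composite mixed table is the same (0.4) table (`compMixG_one`), so `tabsCompGW ctrOff Lc 1 (cΛ·wM1) w ≅ symTablesAn1S2w 3 Lc cΛ w`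
as well. -/
theorem tabsCompGW_one_heq_symTablesAn1S2w (hLc : 1 ≤ Lc) (cΛ w : ℝ) :
    HEq (tabsCompGW (r := ctrOff (3 + 1) Lc) (L := Lc) 1 hLc (ctrOff_mem_box hLc) (fun j => cΛ * wM1 3 Lc j) w) (symTablesAn1S2w 3 Lc cΛ w) := by
  refine symTables_heq_of_fields (pow_one Lc) ?_ ?_ ?_ ?_ ?_
  · rw [tabsCompGW_V, symTablesAn1S2w_V]
    exact compV_one (ctrOff_mem_box hLc)
  · rw [tabsCompGW_H, symTablesAn1S2w_H]
    exact compH_one (ctrOff_mem_box hLc)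
  · rw [symTablesAn1S2w_M]
    funext j μ y
    rw [M1Of_apply]
    show (cΛ * wM1 3 Lc j) • compH (ctrOff (3 + 1) Lc) Lc 1 μ y = _
    rw [compH_one (ctrOff_mem_box hLc)]
    rfl
  · rw [tabsCompGW_vh₂S, symTablesAn1S2w_vh₂S]
    exact compB_ctrOff_one hLc
  · rw [tabsCompGW_mixFF, symTablesAn1S2w_mixFF, compMixG_one (ctrOff_mem_box hLc)]
    rfl

end Anchor

/-! ## §5 Transported to the one-shot kernel -/

section Kernel

variable {Lc : ℕ} [NeZero Lc]

/-- [folklore] **THE LEVEL-0 ONE-SHOT KERNEL OF THE COMB LITERAL OVER THE WEIGHTED DEPTH-ONE COMPOSITE RECORD (blocking `Lc¹`) EQUALS THE ONE OVER `symTablesAn1S2w 3 Lc cΛ w`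
(blocking `Lc`)**, any first-order pin `c` and border pin `b`. -/
theorem TOf_JsB12CombShSym_tabsCompW_one (hLc : Odd Lc) (N : ℕ) (cΛ w c b : ℝ) :
    TOf (N := Lc ^ 1) (JsB12CombShSym (Lc := Lc ^ 1) hLc.pow N
        (tabsCompW (r := ctrOff (3 + 1) Lc) (L := Lc) 1 hLc.pos (ctrOff_mem_box hLc.pos) (fun j => cΛ * wM1 3 Lc j) w) c b 0)
      = TOf (N := Lc) (JsB12CombShSym hLc N (symTablesAn1S2w 3 Lc cΛ w) c b 0) :=
  TOf_JsB12CombShSym_congr_heq hLc.pow hLc (pow_one Lc) N (tabsCompW_one_heq_symTablesAn1S2w hLc.pos cΛ w) c b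

/-- [folklore] **THE ANCHOR ROW FOR ANY SCALE-INDEXED RECORD WHOSE SCALE-1 MEMBER IS THE WEIGHTED DEPTH-ONE COMPOSITE RECORD**:
`TshotOf Lc (JcOfTabs hLc N tabs cΛ cB) 1 = TbalOf Lc (JsB12CombShSym hLc N (symTablesAn1S2w 3 Lc (cΛ 1) (w 1)) (cΛ 1) (cB 1)) 0` — the END″'s `hbase` at the weighted root
(at `cΛ 1 := w·cΛ₀`, `w 1 := w` this is root D6's literal `JsB12CombShSym hLc N (symTablesAn1S2w 3 Lc (w·cΛ₀) w) (w·cΛ₀) cB` at level 0). -/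
theorem TshotOf_JcOfTabs_one_of_tabsCompW (hLc : Odd Lc) (N : ℕ) (tabs : ∀ m : ℕ, SymTables 3 (Lc ^ m)) (cΛ cB w : ℕ → ℝ)
    (h1 : tabs 1 = tabsCompW (r := ctrOff (3 + 1) Lc) (L := Lc) 1 hLc.pos (ctrOff_mem_box hLc.pos) (fun j => cΛ 1 * wM1 3 Lc j) (w 1)) :
    TshotOf Lc (JcOfTabs hLc N tabs cΛ cB) 1 = TbalOf Lc (JsB12CombShSym hLc N (symTablesAn1S2w 3 Lc (cΛ 1) (w 1)) (cΛ 1) (cB 1)) 0 :=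
  TshotOf_JcOfTabs_one hLc N tabs cΛ cB _ (h1 ▸ tabsCompW_one_heq_symTablesAn1S2w hLc.pos (cΛ 1) (w 1))

/-- [folklore] the same for the graded weighted record at scale 1. -/
theorem TshotOf_JcOfTabs_one_of_tabsCompGW (hLc : Odd Lc) (N : ℕ) (tabs : ∀ m : ℕ, SymTables 3 (Lc ^ m)) (cΛ cB w : ℕ → ℝ)
    (h1 : tabs 1 = tabsCompGW (r := ctrOff (3 + 1) Lc) (L := Lc) 1 hLc.pos (ctrOff_mem_box hLc.pos) (fun j => cΛ 1 * wM1 3 Lc j) (w 1)) :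
    TshotOf Lc (JcOfTabs hLc N tabs cΛ cB) 1 = TbalOf Lc (JsB12CombShSym hLc N (symTablesAn1S2w 3 Lc (cΛ 1) (w 1)) (cΛ 1) (cB 1)) 0 :=
  TshotOf_JcOfTabs_one hLc N tabs cΛ cB _ (h1 ▸ tabsCompGW_one_heq_symTablesAn1S2w hLc.pos (cΛ 1) (w 1))

end Kernel

end Summit.QuantumFields.BalabanUV.Beta.CompositeOneShotTablesWeighted

end
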